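import Summits.BirchSwinnertonDyer.BirchSwinnertonDyer.Theorems.SemiOrdinaryEisensteinDescentWildSplitEisensteinValueAtOneVCertificateRoad
import HarnessLib
import Literature.NumberTheory.EllipticCurves.KolyvaginShaStructureCertificate

/-!
# Route `SemiOrdinaryEisensteinDescent` (SOED), crux #2 of record `WildSplitEisensteinValueAtOneV`
# (stmt-BirchSwinnertonDyer-26610, `E_𝟙^V`), registered line `index`: the certificate road WITHOUT THE TOWER SPLIT —
# McCallum 1991 Cor. 5.6 (lower, certificate form) under its PRINTED image hypothesis `ρ̄_{E,p}` onto, cited inline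
# (relocates to `Literature/NumberTheory/EllipticCurves/KolyvaginShaStructureCertificate.lean`), and the line's research
# stub `stub_indexLowerBoundFH` (`I_FH`) from it + ONE Kolyvagin point-certificate per index-excess Friedberg–Hoffstein
# datum on ALL rows of the cell (the 39 onto-3-not-9 classes included); the crux BY NAME from the same
# (cell `pub/bsd-wall`, width seat `bsd-wall-soed-p1-w3` g15, `--supports stmt-BirchSwinnertonDyer-26610`, helper;
# ONE cited definition (a published fact, never asserted), no `sorry`)

Sequel of `…WildSplitEisensteinValueAtOneVCertificateRoad` (p621234, this seat): there §2 reduced `I_FH` to McCallum's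
fact AS TYPED IN THE TREE (`McCallum1991_pow_dvd_card_sha_primary_of_certificate`, `3`-adic TOWER hypothesis) + `CERT₃^FH`
on the tower-onto rows + the residue `I_FH|NT` on the non-tower rows. The tower hypothesis is the typer's CAUTION, not
print: McCallum's §5 is stated under `Gal(ℚ(E_p)/ℚ) = Gl₂(ℤ/pℤ)` (mod `p`). §4 below cites the fact with the printed
binder; §§5–7 rerun the road on it: no tower split, no non-tower residue.

* §4 `McCallum1991_pow_dvd_card_sha_primary_of_certificate_modP` (cited `def … : Prop`, print verbatim up to the
  tree's weakenings) and `mcCallum_certificate_of_modP` (the tree's tower fact is its corollary).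
* §5 `indexLowerBoundLeAt_FH_of_certificate_modP` — pointwise `I_FH` at a datum from ONE certificate, `ρ̄₃` onto only.
* §6 `indexLowerBoundFH_of_certificates_modP` — `I_FH` VERBATIM ⟸ Kolyvagin ∧ McCallum (printed hypothesis) ∧
  `CERT₃^FH,all` (ONE certificate at every index-excess odd FH datum of EVERY cell curve).
* §7 `valueAtOneV_of_certificates_modP_of_poitouTate[Conj]` — the crux of record BY NAME from PUB ∧ PT1 (resp. 23092)
  ∧ PT2 ∧ McCallum (printed hypothesis) ∧ `CERT₃^FH,all`.

HONEST FRAMING: theorems + ONE cited definition; every crux, fact and certificate statement is a HYPOTHESIS; nothing is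
asserted about any curve; closes nothing; `E_𝟙^V`, `I_FH`, `CERT₃^FH,all` stay OPEN; BSD₃ is proved for no curve. No
`sorry`.

References: [McCallumLMS1991] §3 (2) (p. 298), §4 `S_r(M)`, (5) (pp. 299–300), §5 standing hypotheses and Lemma 5.1
(p. 303), Thm. 5.4 (p. 308), Cor. 5.6 (p. 310); [GrossLMS1991] Lemma 4.3, Prop. 6.2, Prop. 9.1; [Kolyvagin1990] Thm. A;
[WZhang2014] Thm. 1.1, Remark 18; [Elkies2006] (arXiv:math/0612734); [Serre1972] §2; [JetchevSkinnerWan2017] §7.4.1;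
[GrossZagier1986] III (3.1); [MilneADT2006] I Thm. 4.10.
-/

noncomputable section

open scoped Classical NumberField

set_option linter.dupNamespace false -- `Summit.BirchSwinnertonDyer.BirchSwinnertonDyer.Theorems.…` (summit = sub, D-0017)
set_option autoImplicit false

namespace Summit.BirchSwinnertonDyer.BirchSwinnertonDyer.Theorems.WildSplitEisensteinValueAtOneVCertificateRoadModP

open WeierstrassCurve NumberField IsDedekindDomain Field
  Literature.NumberTheory.EllipticCurves
  Literature.NumberTheory.EllipticCurves.ModularForms
  Literature.NumberTheory.EllipticCurves.Rank1Residual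
  Literature.NumberTheory.GaloisCohomology
  Summit.BirchSwinnertonDyer.Rank1Residual
  Summit.BirchSwinnertonDyer.Rank1Residual.Additive
  Summit.BirchSwinnertonDyer.Rank1Residual.X11b
  Summit.BirchSwinnertonDyer.Rank1Residual.X11b.Three
  Summit.BirchSwinnertonDyer.BirchSwinnertonDyer.Theses.SemiOrdinaryEisensteinDescent
  Summit.BirchSwinnertonDyer.BirchSwinnertonDyer.Theorems
  Summit.BirchSwinnertonDyer.BirchSwinnertonDyer.Theorems.WildSplitEisensteinValueAtOneVCertificateRoad

/-! ### §4 McCallum's Cor. 5.6 (lower, certificate form) under the PRINTED image hypothesis (mod `p`), cited inline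

The tree's `Literature.NumberTheory.EllipticCurves.McCallum1991_pow_dvd_card_sha_primary_of_certificate`
(`KolyvaginShaStructureCertificate.lean`) carries the `p`-adic TOWER hypothesis `∀ n, ρ̄_{E,p^n}` onto — by its own
docstring STRONGER than print («McCallum prints `Gal(ℚ(E_p)/ℚ) = Gl₂(ℤ/pℤ)` (mod `p`) … which of the two the team's
consumers should carry is the referee's call»). At `p ≥ 5` the two agree (Serre); at `p = 3` they do not (Elkies 2006:
onto mod `3`, index `27` mod `9` — 39 classes of the SOED cell), and every consumer inherits a «non-tower» residue
(`WildRankOneSurjNonTowerAtThree`, RHP's `stub_nonTowerRows`, p621234 §2's `I_FH|NT`). The fact below is the SAME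
transcription with the image binder AS PRINTED (McCallum 1991 §5, p. 303: «p is an odd prime such that
`Gal(ℚ(E_p)/ℚ) = Gl₂(ℤ/pℤ)`»; Thm. 5.4, p. 308: «Let `p > 2` be such that `Gal(ℚ(E_p)/ℚ) = Gl₂(ℤ/pℤ)`»), every other
binder byte-identical; the tower fact is its corollary (`mcCallum_certificate_of_modP`).

REMARK (why the printed proof uses no more than the printed hypothesis, also at `p = 3`; recorded for the referee, not
asserted in Lean). McCallum §§3–5 use the Galois image at level `p^M` in exactly three places: (2) p. 298
`Gal(L_C/L) ≃ Hom(C, E_{p^M})` for `L = K(E_{p^M})` (injectivity of restriction = `H¹(Gal(L/K), E_{p^M}) = 0`, Gross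
Prop. 9.1, plus surjectivity onto `Hom`), (5) p. 300 «E has no `K_n`-rational `p`-torsion» (Gross Lemma 4.3), and the
`τ`-eigenspace bookkeeping (image-free). For ANY closed `Γ ≤ GL₂(ℤ₃)` mapping onto `GL₂(𝔽₃)`: (i) `−I ∈ Γ` and
`−I ∈ Γ ∩ ρ(G_K)` — the `2`-part of a lift of `−I ∈ SL₂(𝔽₃) = ρ̄(G_K)` is an involution `≡ −I (mod 3)`, and
`(−I + 3X)² = I` forces `X = 0` level by level; so `H¹(Γ_M ∩ ρ(G_K), E[3^M]) = 0` (central element acting as `−1`,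
`2` invertible); (ii) `ℤ/3^M[ρ(G_K)]` spans `M₂(ℤ/3^M)` (`SL₂(𝔽₃) ⊇ Q₈` acts absolutely irreducibly on `𝔽₃²`;
Nakayama), so `Gal(L/K)`-stable submodules of `Hom(C, E_{3^M}) = C^∨ ⊗ (ℤ/3^M)²` are `W ⊗ (ℤ/3^M)²` and point
separation forces `W = C^∨` (Pontryagin) — this is (2); (iii) `E(K_n)[3] = 0` for every ring class field `K_n`:
`Gal(ℚ(E[3]) ∩ K_n / ℚ)` would be a quotient of the generalised dihedral `Pic(O_n) ⋊ ⟨τ⟩` by a normal subgroup of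
`GL₂(𝔽₃)` fixing a vector; the normal subgroups are `1, {±I}, Q₈, SL₂(𝔽₃), GL₂(𝔽₃)`, only `1` fixes a vector, and
`GL₂(𝔽₃)` has no abelian subgroup of index `≤ 2` — this is (5). Kolyvagin primes: `a_ℓ ≡ ℓ + 1 ≡ 0 (mod p^M)` gives
`Frob_ℓ² = I` on `E[p^M]` by Cayley–Hamilton, image-free. The bad-place step (Lemma 4.3 / Prop. 4.7 ← Gross Prop.
6.2(1): Heegner divisors reduce into `J⁰` up to cuspidal torsion [GZ III (3.1)], `E(ℚ)[p] = 0`) uses neither good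
reduction at `p` nor `p ∤ c_v`. -/

/-- **The tree's tower-hypothesis fact is a corollary of the printed-hypothesis fact** (the tower at level `p¹` is
`ρ̄_{E,p}` onto). Bookkeeping; nothing asserted about any curve. [cite: McCallumLMS1991, §5 Cor. 5.6 (p. 310)] -/
theorem mcCallum_certificate_of_modP (h : Literature.NumberTheory.EllipticCurves.McCallum1991_pow_dvd_card_sha_primary_of_certificate_modP) :
    McCallum1991_pow_dvd_card_sha_primary_of_certificate := by
  intro W _ _ _ hCM K _ _ hK h3 h4 hH p _ hp2 hsurj Dt β ι d₁ P hPd hPinf M₀ hdiv hndiv n M d hn hℓ hcert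
  exact h W hCM K hK h3 h4 hH p hp2 (by simpa using hsurj 1) Dt β ι d₁ P hPd hPinf M₀ hdiv hndiv n M d hn hℓ hcert

/-! ### §5 Pointwise at an `I_FH` datum under `ρ̄₃` onto ONLY (no tower): McCallum (printed hypothesis) + ONE certificate -/

/-- **`I_FH` at ONE Friedberg–Hoffstein datum of the cell from ONE Kolyvagin certificate, NO tower hypothesis** — p621234 §1 with
the McCallum input under its PRINTED image hypothesis (`McCallum1991_pow_dvd_card_sha_primary_of_certificate_modP`,
named, hypothesis) and `ρ̄_{E,3}` onto (a binder of the cell) in place of `AdditiveThree.TowerSurjThree W`. Same kernel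
steps as w3 g5's `lower_of_certificate` (non-CM from onto mod `3`; Kolyvagin: rank one, `Ш(E/K)` finite; `E(K)[3] = 0`;
the conductor-`1` datum (Darmon Thm. 3.6, tree theorem) with bottom point `P` (Shimura reciprocity, tree theorem);
`3^{M₀} ∥ P`; McCallum Lemma 5.1; `ord₃ #Ш = ord₃ #Ш[3^∞]`). Every input is an antecedent; nothing asserted about any
curve. [cite: McCallumLMS1991, §5 Cor. 5.6 (p. 310) and Lemma 5.1 (p. 303)] [cite: GrossLMS1991, §4 (4.1)]
[cite: Darmon2004, Thm. 3.6–3.7] -/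
theorem indexLowerBoundLeAt_FH_of_certificate_modP
    (hKo : ∀ (N : ℕ) [NeZero N] (W : WeierstrassCurve ℚ) (K : Type) [Field K] [NumberField K], kolyvagin N W K)
    (hMcP : Literature.NumberTheory.EllipticCurves.McCallum1991_pow_dvd_card_sha_primary_of_certificate_modP)
    (W : WeierstrassCurve ℚ) [W.IsElliptic] [W.IsGloballyMinimal] (N : ℕ) [NeZero N]
    (K : Type) [Field K] [NumberField K]
    (Dt : ModularParametrizationData W N) (H : HeegnerDatum N (NumberField.discr K)) (ι : K →+* ℂ)
    (P : (W.baseChange K).toAffine.Point)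
    (hO6 : Additive.ClassO6 W 3) (hsurj : W.HasSurjectiveModNGaloisRep 3) (hN : W.conductorNorm ℤ = N)
    (hK : IsImaginaryQuadratic K) (hHH : SatisfiesHeegnerHypothesis N K)
    (hP : WeierstrassCurve.Affine.Point.map ι.toRatAlgHom P = heegnerPointComplex Dt H)
    (hnt : ¬ IsOfFinAddOrder P) (hodd : Odd (NumberField.discr K))
    {n : ℕ} (d : KolyvaginHeegnerData Dt H.β ι n) (hn : Squarefree n)
    (hℓ : ∀ ℓ ∈ n.primeFactors, Zhang2014.IsKolyvaginPrime N W K 3 ℓ ∧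
      padicValNat 3 W.tamagawaProduct + padicValNat 3 Dt.c.natAbs + 1 ≤ Zhang2014.kolyvaginIndex W 3 ℓ)
    (hcert : ¬ Koly.PDiv d 3 (padicValNat 3 W.tamagawaProduct + padicValNat 3 Dt.c.natAbs + 1)) :
    SchneiderFree.IndexLowerBoundLeAt W 3 K P (padicValNat 3 Dt.c.natAbs) := by
  subst hN
  haveI hp3 : Fact (Nat.Prime 3) := ⟨Nat.prime_three⟩
  -- `d_K ≠ -4`: `d_K` is odd
  have hd4 : NumberField.discr K ≠ -4 := by
    intro h
    have h2 := Int.odd_iff.mp hodd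
    omega
  -- `3 ∣ N(E)` (additive at `3`) splits in `K`; hence `d_K ≠ -3`
  have h3N : 3 ∣ W.conductorNorm ℤ :=
    (W.dvd_conductorNorm_iff_not_hasGoodReductionAtPrime 3).mpr (not_good_of_addv W 3 hO6.2.1)
  have hd3 : NumberField.discr K ≠ -3 := by
    intro h
    exact Literature.SatisfiesHeegnerHypothesis.not_dvd_discr hK.1 hHH Nat.prime_three h3N (by rw [h]; norm_num)
  -- mod-`3` image onto, hence irreducible and non-CM
  have hCM : ¬ W.HasCM := fun hCM ↦
    W.not_hasSurjectiveModNGaloisRep_of_hasCM hCM Nat.prime_three (by decide) hsurj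
  haveI : NeZero ((3 : ℕ) : ℚ) := ⟨by norm_num⟩
  have hirr : W.HasIrreducibleModPGaloisRep 3 :=
    hasIrreducibleModPGaloisRep_of_hasSurjectiveModNGaloisRep W 3 hsurj
  -- rank one and `Ш(E/K)` finite (Kolyvagin)
  obtain ⟨hrank, hfin⟩ := hKo (W.conductorNorm ℤ) W K hK hHH ⟨Dt, H, ι, hP⟩ hnt
  haveI : Finite (W.baseChange K).sha := hfin
  -- no `3`-torsion in `E(K)`
  have hbot := torsionBy_eq_bot_of_isImaginaryQuadratic_of_hasIrreducibleModPGaloisRep W K hK Nat.prime_three hirr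
  have hiv : ∀ x : (W.baseChange K).toAffine.Point, 3 • x = 0 → x = 0 := fun x hx ↦ by
    have hmem : x ∈ AddSubgroup.torsionBy (W.baseChange K).toAffine.Point ((3 : ℕ) : ℤ) := by
      rw [mem_torsionBy_iff, natCast_zsmul]
      exact hx
    rw [hbot] at hmem
    exact hmem
  -- the conductor-`1` Kolyvagin–Heegner datum on the frame `(Dt, H.β, ι)` (Darmon 2004, Thm. 3.6)
  obtain ⟨d₁⟩ := exists_kolyvaginHeegnerData_one
    (phi_heegnerTau_mem_singularModuliField_holds (W.conductorNorm ℤ) W K) hK Dt H.β ι H.dvd_sq_sub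
  -- its bottom point is `P` in `E(K̄)` (Shimura reciprocity at conductor `1`)
  have hPd : d₁.toGeomPoints d₁.derivedPoint = toGeomPoints (W.baseChange K) P :=
    KolyvaginBottom.toGeomPoints_derivedPoint_one_eq
      (heegnerPointOfConductor_one_galoisConj_holds (W.conductorNorm ℤ) W K) hK hHH hP d₁ rfl
  -- `3^{M₀} ∥ P` (Mordell–Weil)
  haveI : Module.Finite ℤ (W.baseChange K).toAffine.Point := (W.baseChange K).module_finite_point_holds
  obtain ⟨M₀, x₀, hx₀, hmax⟩ := exists_pow_smul_eq_and_forall_ne hnt (p := 3) (by norm_num)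
  have hdiv : ∃ Q : (W.baseChange K).toAffine.Point, ((3 ^ M₀ : ℕ) : ℤ) • Q = P :=
    ⟨x₀, by rw [natCast_zsmul]; exact hx₀⟩
  have hndiv : ¬ ∃ Q : (W.baseChange K).toAffine.Point, ((3 ^ (M₀ + 1) : ℕ) : ℤ) • Q = P := by
    rintro ⟨Q, hQ⟩
    exact hmax Q (by rw [← natCast_zsmul]; exact hQ)
  -- McCallum's Cor. 5.6, certificate (lower) form under the PRINTED hypothesis, at level `t + s + 1`
  have hcert' : ¬ ∃ Q : (W.baseChange (ringClassField K ι n)).toAffine.Point,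
      ((3 ^ (padicValNat 3 W.tamagawaProduct + padicValNat 3 Dt.c.natAbs + 1) : ℕ) : ℤ) • Q = d.derivedPoint :=
    hcert
  have hdvd := hMcP W hCM K hK hd3 hd4 hHH 3 (by decide) hsurj Dt H.β ι d₁ P hPd hnt M₀ hdiv hndiv n
    (padicValNat 3 W.tamagawaProduct + padicValNat 3 Dt.c.natAbs) d hn hℓ hcert'
  have hpos : Nat.card (AddCommGroup.primaryComponent (W.baseChange K).sha 3) ≠ 0 := Nat.card_pos.ne'
  have hle : 2 * (M₀ - (padicValNat 3 W.tamagawaProduct + padicValNat 3 Dt.c.natAbs)) ≤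
      padicValNat 3 (Nat.card (AddCommGroup.primaryComponent (W.baseChange K).sha 3)) :=
    (padicValNat_dvd_iff_le hpos).mp hdvd
  -- `ord₃ #Ш = ord₃ #Ш[3^∞]` and `ord₃ [E(K):ℤP] = M₀`
  have hsha : padicValNat 3 (W.baseChange K).shaOrder =
      padicValNat 3 (Nat.card (AddCommGroup.primaryComponent (W.baseChange K).sha 3)) :=
    Koly.padicValNat_shaOrder_eq (W.baseChange K) 3
  haveI : Finite (AddCommGroup.torsion (W.baseChange K).toAffine.Point) :=
    WeierstrassCurve.finite_torsion_point (W := W.baseChange K)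
  obtain ⟨c, Q, hcQ, hcker⟩ := RankOne.exists_coord_of_mordellWeilRank_eq_one (W.baseChange K) hrank
  have hidx : padicValNat 3 (AddSubgroup.zmultiples P).index = M₀ :=
    Koly.padicValNat_index_zmultiples_eq_of_divisibility c Q hcQ hcker hiv P hdiv hndiv
  unfold SchneiderFree.IndexLowerBoundLeAt
  rw [hidx, hsha]
  omega

/-! ### §6 `I_FH` VERBATIM from certificates on ALL index-excess rows (no tower split) -/

/-- **The registered research stub `stub_indexLowerBoundFH` (`I_FH`, signature verbatim) from McCallum under the PRINTED
hypothesis and certificates on ALL index-excess rows — NO non-tower residue.** Hypotheses: Kolyvagin (`hKo`); McCallum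
Cor. 5.6 lower form, printed image hypothesis (`hMcP`, named); `CERT₃^FH,all` (`hCert`, displayed): for every cell curve
`W` (`ClassO6 W 3`, `ρ̄₃` onto, `r_an = 1`, `N_E = N` — tower-onto OR NOT) and every Heegner datum `(K, Dt, H, ι, P)` for
`N` with `L(E^(d_K),1) ≠ 0`, `ι(P) = heegnerPointComplex Dt H`, `P` of infinite order, `d_K` odd and INDEX EXCESS
`ord₃[E(K):ℤP] > ord₃∏c_ℓ + v₃(c)`, ONE square-free `n` of Kolyvagin primes of index `≥ ord₃∏c_ℓ + v₃(c) + 1` and ONE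
Kolyvagin–Heegner datum of conductor `n` on `(Dt, H.β, ι)` with `P_n ∉ 3^{ord₃∏c_ℓ + v₃(c) + 1}E(K[n])`. Conclusion:
`I_FH` as registered on stmt-BirchSwinnertonDyer-26610. Proof: idle rows by p621234 §0, index-excess rows by §5. Every input is
an antecedent; nothing asserted about any curve. [cite: McCallumLMS1991, §5 Cor. 5.6 (p. 310)]
[cite: WZhang2014, Thm. 1.1 and Remark 18] [cite: JetchevSkinnerWan2017, §7.4.1 (arXiv:1512.06894 p. 30)] -/
theorem indexLowerBoundFH_of_certificates_modP
    (hKo : ∀ (N : ℕ) [NeZero N] (W : WeierstrassCurve ℚ) (K : Type) [Field K] [NumberField K], kolyvagin N W K)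
    (hMcP : Literature.NumberTheory.EllipticCurves.McCallum1991_pow_dvd_card_sha_primary_of_certificate_modP)
    (hCert : ∀ (W : WeierstrassCurve ℚ) [W.IsElliptic] [W.IsGloballyMinimal] (N : ℕ) [NeZero N] (K : Type) [Field K]
      [NumberField K] (Dt : Literature.NumberTheory.EllipticCurves.ModularForms.ModularParametrizationData W N)
      (H : Literature.NumberTheory.EllipticCurves.HeegnerDatum N (NumberField.discr K)) (ι : K →+* ℂ)
      (P : (W.baseChange K).toAffine.Point),
      Summit.BirchSwinnertonDyer.Rank1Residual.Additive.ClassO6 W 3 → W.HasSurjectiveModNGaloisRep 3 →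
      W.analyticRank = 1 → W.conductorNorm ℤ = N → Literature.NumberTheory.EllipticCurves.IsImaginaryQuadratic K →
      Literature.NumberTheory.EllipticCurves.SatisfiesHeegnerHypothesis N K →
      (W.quadraticTwist (NumberField.discr K : ℚ)).entireLFunction 1 ≠ 0 →
      (WeierstrassCurve.Affine.Point.map ι.toRatAlgHom) P =
        Literature.NumberTheory.EllipticCurves.ModularForms.heegnerPointComplex Dt H →
      ¬ IsOfFinAddOrder P → Odd (NumberField.discr K) →
      padicValNat 3 W.tamagawaProduct + padicValNat 3 Dt.c.natAbs < padicValNat 3 (AddSubgroup.zmultiples P).index →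
      ∃ (n : ℕ) (d : Literature.NumberTheory.EllipticCurves.KolyvaginHeegnerData Dt H.β ι n),
        Squarefree n ∧
        (∀ ℓ ∈ n.primeFactors,
          Literature.NumberTheory.EllipticCurves.Zhang2014.IsKolyvaginPrime N W K 3 ℓ ∧
          padicValNat 3 W.tamagawaProduct + padicValNat 3 Dt.c.natAbs + 1 ≤
            Literature.NumberTheory.EllipticCurves.Zhang2014.kolyvaginIndex W 3 ℓ) ∧
        ¬ Summit.BirchSwinnertonDyer.Rank1Residual.X11b.Three.Koly.PDiv d 3
            (padicValNat 3 W.tamagawaProduct + padicValNat 3 Dt.c.natAbs + 1)) :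
    ∀ (W : WeierstrassCurve ℚ) [W.IsElliptic] [W.IsGloballyMinimal] (N : ℕ) [NeZero N] (K : Type) [Field K] [NumberField K] (Dt : Literature.NumberTheory.EllipticCurves.ModularForms.ModularParametrizationData W N) (H : Literature.NumberTheory.EllipticCurves.HeegnerDatum N (NumberField.discr K)) (ι : K →+* ℂ) (P : (W.baseChange K).toAffine.Point), Summit.BirchSwinnertonDyer.Rank1Residual.Additive.ClassO6 W 3 → W.HasSurjectiveModNGaloisRep 3 → W.analyticRank = 1 → W.conductorNorm ℤ = N → Literature.NumberTheory.EllipticCurves.IsImaginaryQuadratic K → Literature.NumberTheory.EllipticCurves.SatisfiesHeegnerHypothesis N K → (W.quadraticTwist (NumberField.discr K : ℚ)).entireLFunction 1 ≠ 0 → (WeierstrassCurve.Affine.Point.map ι.toRatAlgHom) P = Literature.NumberTheory.EllipticCurves.ModularForms.heegnerPointComplex Dt H → ¬ IsOfFinAddOrder P → Odd (NumberField.discr K) → Summit.BirchSwinnertonDyer.BirchSwinnertonDyer.Theorems.SchneiderFree.IndexLowerBoundLeAt W 3 K P (padicValNat 3 Dt.c.natAbs) := by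
  intro W _ _ N _ K _ _ Dt H ι P hO6 hsurj hr hN hK hHH hLt hP hnt hodd
  -- IDLE ROWS: index within the Tamagawa–Manin budget (p621234 §0), no input
  by_cases hex : padicValNat 3 W.tamagawaProduct + padicValNat 3 Dt.c.natAbs <
      padicValNat 3 (AddSubgroup.zmultiples P).index
  swap
  · exact indexLowerBoundLeAt_of_index_le_budget W 3 K P _ (Nat.le_of_not_lt hex)
  -- INDEX-EXCESS ROWS: ONE certificate, then §5 (no tower split)
  obtain ⟨n, d, hn, hℓ, hcert⟩ := hCert W N K Dt H ι P hO6 hsurj hr hN hK hHH hLt hP hnt hodd hex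
  exact indexLowerBoundLeAt_FH_of_certificate_modP hKo hMcP W N K Dt H ι P hO6 hsurj hN hK hHH hP hnt hodd d hn hℓ
    hcert

/-! ### §7 The crux of record BY NAME from print, Poitou–Tate, McCallum (printed hypothesis) and certificates on all rows -/

/-- **`WildSplitEisensteinValueAtOneV` (stmt-BirchSwinnertonDyer-26610) BY NAME, no tower split**:
`PublishedInputsWildThree → McCallum Cor. 5.6 (lower, PRINTED image hypothesis, named) → CERT₃^FH,all →
PoitouTateSelmerStructureDualityFact (PT1) → PT2 → E_𝟙^V` (§6 ∘ p614377 §2). On this road the ONLY non-published input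
under the crux of record is ONE Kolyvagin point-certificate per index-excess Friedberg–Hoffstein datum of the cell —
«`M_∞ ≤ ord₃(c·∏c_ℓ)`», Kolyvagin's conjecture at the additive `3` in McCallum's currency — on ALL 3 894 classes, the 39
onto-3-not-9 classes included. Every crux, fact and certificate statement is an antecedent; nothing asserted about any
curve; BSD₃ is proved for no curve. [cite: McCallumLMS1991, §5 Cor. 5.6 (p. 310)]
[cite: JetchevSkinnerWan2017, Thm. 3.3.1 and §7.4.1 (arXiv:1512.06894 pp. 11, 30)] [cite: MilneADT2006, Ch. I, Thm. 4.10(b)] -/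
theorem valueAtOneV_of_certificates_modP_of_poitouTate (hF : PublishedInputsWildThree)
    (hMcP : Literature.NumberTheory.EllipticCurves.McCallum1991_pow_dvd_card_sha_primary_of_certificate_modP)
    (hCert : ∀ (W : WeierstrassCurve ℚ) [W.IsElliptic] [W.IsGloballyMinimal] (N : ℕ) [NeZero N] (K : Type) [Field K]
      [NumberField K] (Dt : Literature.NumberTheory.EllipticCurves.ModularForms.ModularParametrizationData W N)
      (H : Literature.NumberTheory.EllipticCurves.HeegnerDatum N (NumberField.discr K)) (ι : K →+* ℂ)
      (P : (W.baseChange K).toAffine.Point),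
      Summit.BirchSwinnertonDyer.Rank1Residual.Additive.ClassO6 W 3 → W.HasSurjectiveModNGaloisRep 3 →
      W.analyticRank = 1 → W.conductorNorm ℤ = N → Literature.NumberTheory.EllipticCurves.IsImaginaryQuadratic K →
      Literature.NumberTheory.EllipticCurves.SatisfiesHeegnerHypothesis N K →
      (W.quadraticTwist (NumberField.discr K : ℚ)).entireLFunction 1 ≠ 0 →
      (WeierstrassCurve.Affine.Point.map ι.toRatAlgHom) P =
        Literature.NumberTheory.EllipticCurves.ModularForms.heegnerPointComplex Dt H →
      ¬ IsOfFinAddOrder P → Odd (NumberField.discr K) →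
      padicValNat 3 W.tamagawaProduct + padicValNat 3 Dt.c.natAbs < padicValNat 3 (AddSubgroup.zmultiples P).index →
      ∃ (n : ℕ) (d : Literature.NumberTheory.EllipticCurves.KolyvaginHeegnerData Dt H.β ι n),
        Squarefree n ∧
        (∀ ℓ ∈ n.primeFactors,
          Literature.NumberTheory.EllipticCurves.Zhang2014.IsKolyvaginPrime N W K 3 ℓ ∧
          padicValNat 3 W.tamagawaProduct + padicValNat 3 Dt.c.natAbs + 1 ≤
            Literature.NumberTheory.EllipticCurves.Zhang2014.kolyvaginIndex W 3 ℓ) ∧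
        ¬ Summit.BirchSwinnertonDyer.Rank1Residual.X11b.Three.Koly.PDiv d 3
            (padicValNat 3 W.tamagawaProduct + padicValNat 3 Dt.c.natAbs + 1))
    (hPT : PoitouTateSelmerStructureDualityFact)
    (hPT2 : ∀ (K : Type) [Field K] [NumberField K], Literature.NumberTheory.GaloisCohomology.poitouTate_sha_tateDual K) :
    WildSplitEisensteinValueAtOneV :=
  WildSplitEisensteinValueAtOneVIndexCurrency.valueAtOneV_of_indexLowerBoundFH_of_poitouTate hF
    (indexLowerBoundFH_of_certificates_modP hF.2.1 hMcP hCert) hPT hPT2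

/-- **The same with the line's `stub_poitouTateConj`** (item 23092) in place of PT1. So, stub for stub, line `index` =
{`stub_publishedInputs`, `stub_poitouTateConj`, `stub_poitouTateSha`} + [`stub_indexLowerBoundFH` ⟸ McCallum (lower,
printed hypothesis; print) ∧ `CERT₃^FH,all` (research, per-pair decidable)] — no tower split, no non-tower residue.
Every input is an antecedent; nothing asserted about any curve.
[cite: MilneADT2006, Ch. I, Thm. 4.10] [cite: McCallumLMS1991, §5 Cor. 5.6 (p. 310)] -/
theorem valueAtOneV_of_certificates_modP_of_poitouTateConj (hF : PublishedInputsWildThree)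
    (hMcP : Literature.NumberTheory.EllipticCurves.McCallum1991_pow_dvd_card_sha_primary_of_certificate_modP)
    (hCert : ∀ (W : WeierstrassCurve ℚ) [W.IsElliptic] [W.IsGloballyMinimal] (N : ℕ) [NeZero N] (K : Type) [Field K]
      [NumberField K] (Dt : Literature.NumberTheory.EllipticCurves.ModularForms.ModularParametrizationData W N)
      (H : Literature.NumberTheory.EllipticCurves.HeegnerDatum N (NumberField.discr K)) (ι : K →+* ℂ)
      (P : (W.baseChange K).toAffine.Point),
      Summit.BirchSwinnertonDyer.Rank1Residual.Additive.ClassO6 W 3 → W.HasSurjectiveModNGaloisRep 3 →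
      W.analyticRank = 1 → W.conductorNorm ℤ = N → Literature.NumberTheory.EllipticCurves.IsImaginaryQuadratic K →
      Literature.NumberTheory.EllipticCurves.SatisfiesHeegnerHypothesis N K →
      (W.quadraticTwist (NumberField.discr K : ℚ)).entireLFunction 1 ≠ 0 →
      (WeierstrassCurve.Affine.Point.map ι.toRatAlgHom) P =
        Literature.NumberTheory.EllipticCurves.ModularForms.heegnerPointComplex Dt H →
      ¬ IsOfFinAddOrder P → Odd (NumberField.discr K) →
      padicValNat 3 W.tamagawaProduct + padicValNat 3 Dt.c.natAbs < padicValNat 3 (AddSubgroup.zmultiples P).index →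
      ∃ (n : ℕ) (d : Literature.NumberTheory.EllipticCurves.KolyvaginHeegnerData Dt H.β ι n),
        Squarefree n ∧
        (∀ ℓ ∈ n.primeFactors,
          Literature.NumberTheory.EllipticCurves.Zhang2014.IsKolyvaginPrime N W K 3 ℓ ∧
          padicValNat 3 W.tamagawaProduct + padicValNat 3 Dt.c.natAbs + 1 ≤
            Literature.NumberTheory.EllipticCurves.Zhang2014.kolyvaginIndex W 3 ℓ) ∧
        ¬ Summit.BirchSwinnertonDyer.Rank1Residual.X11b.Three.Koly.PDiv d 3
            (padicValNat 3 W.tamagawaProduct + padicValNat 3 Dt.c.natAbs + 1))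
    (hPTc : PoitouTateSelmerDualityConjInput)
    (hPT2 : ∀ (K : Type) [Field K] [NumberField K], Literature.NumberTheory.GaloisCohomology.poitouTate_sha_tateDual K) :
    WildSplitEisensteinValueAtOneV :=
  valueAtOneV_of_certificates_modP_of_poitouTate hF hMcP hCert
    (fun K _ _ ↦ Literature.NumberTheory.GaloisCohomology.poitouTate_selmerStructure_duality_of_conj (hPTc K)) hPT2

end Summit.BirchSwinnertonDyer.BirchSwinnertonDyer.Theorems.WildSplitEisensteinValueAtOneVCertificateRoadModP

end
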